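import Mathlib

/-!
# Lower pins force violations AT THE SCHEME VOLUME under superlogarithmic physical volume

Line `Sketch` of crux `PauliWegnerSea.ChiralOneScaleTrajectory` (stmt-QuantumFields-17512), `N_f = 3` preparation.
`frequently_violation_of_eventual_lowerPin` places the violating distance `n` far out at a FIXED cutoff `k`
(`S = n → ∞`), where no sign information is available.  If the physical volume of the regularisation is
superlogarithmic, `a_k L_k / (1 + |log a_k|) → ∞` (the hypothesis of the tree's
`chiralOneScaleTrajectory_of_clauses_superlog`), the violation can instead be placed at the scheme's OWN
volume and the maximal axis distance, `S = n = L_k`, EVENTUALLY in `k`: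
`C e^{-ε a_k L_k} < F k L_k L_k` for every `C` and every rate `ε > C₁` — because
`(ε - C₁) a_k L_k - p log(L_k + 1) → +∞` (`log(L_k+1) ≤ log(a_k L_k + 1) + |log a_k|` for `a_k ≤ 1`, and both
terms are `o(a_k L_k)`).  This is where clause (iv) of the crux (sign coherence at side `2L_k+1`) lives.
Pure real analysis; folklore.
-/

namespace Summit.QuantumFields.QCD.Cruxes.ChiralOneScaleTrajectory.GoldstoneWitness

open Filter Real

/-- **The exponent at the scheme volume diverges**: if `a_k > 0`, `a_k ≤ 1` eventually,
`a_k L_k / (1 + |log a_k|) → ∞` and `δ > 0`, then `δ a_k L_k - q log(L_k + 1) → +∞` for every real `q`.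
[folklore] -/
theorem tendsto_mul_vol_sub_log_atTop (a : ℕ → ℝ) (L : ℕ → ℕ) {δ : ℝ} (hδ : 0 < δ) (q : ℝ)
    (ha : ∀ k, 0 < a k) (ha1 : ∀ᶠ k in atTop, a k ≤ 1)
    (hvol : Tendsto (fun k => a k * L k / (1 + |Real.log (a k)|)) atTop atTop) :
    Tendsto (fun k => δ * (a k * L k) - q * Real.log ((L k : ℝ) + 1)) atTop atTop := by
  -- `V_k := a_k L_k → ∞` and `ℓ_k := 1 + |log a_k| = o(V_k)`
  set V : ℕ → ℝ := fun k => a k * L k with hV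
  set ℓ : ℕ → ℝ := fun k => 1 + |Real.log (a k)| with hℓ
  have hℓpos : ∀ k, 0 < ℓ k := fun k => by simp only [hℓ]; positivity
  have hV0 : ∀ k, 0 ≤ V k := fun k => by simp only [hV]; exact mul_nonneg (ha k).le (Nat.cast_nonneg _)
  have hVtop : Tendsto V atTop atTop := by
    -- `V = (V/ℓ) · ℓ` with `ℓ ≥ 1`
    refine tendsto_atTop_mono (fun k => ?_) hvol
    change a k * L k / (1 + |Real.log (a k)|) ≤ a k * L k
    rw [div_le_iff₀ (hℓpos k)]
    have h1 : (1 : ℝ) ≤ 1 + |Real.log (a k)| := le_add_of_nonneg_right (abs_nonneg (Real.log (a k)))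
    nlinarith [hV0 k, h1]
  -- bound `log(L_k + 1) ≤ log(V_k + 1) + |log a_k| ≤ V_k/?` : we use `log (L+1) ≤ log (V+1) + |log a|` for `a ≤ 1`
  have hlogL : ∀ᶠ k in atTop, Real.log ((L k : ℝ) + 1) ≤ Real.log (V k + 1) + |Real.log (a k)| := by
    filter_upwards [ha1] with k hk
    have hak := ha k
    -- `L + 1 ≤ (V + 1)/a` since `a L = V` and `a ≤ 1`
    have h1 : ((L k : ℝ) + 1) ≤ (V k + 1) / a k := by
      rw [le_div_iff₀ hak]
      have : (L k : ℝ) * a k = V k := by simp only [hV]; ring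
      nlinarith [this, hk, (Nat.cast_nonneg (L k) : (0 : ℝ) ≤ (L k : ℝ))]
    have h2 : 0 < (L k : ℝ) + 1 := by positivity
    calc Real.log ((L k : ℝ) + 1) ≤ Real.log ((V k + 1) / a k) := Real.log_le_log h2 h1
      _ = Real.log (V k + 1) - Real.log (a k) := by
          rw [Real.log_div (by linarith [hV0 k]) hak.ne']
      _ ≤ Real.log (V k + 1) + |Real.log (a k)| := by linarith [neg_abs_le (Real.log (a k))]
  -- Main estimate: `δ V - q log(L+1) ≥ δ V - |q| (log(V+1) + |log a|) ≥ δ V - |q| (√… )`; we show it exceeds any `B`.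
  refine tendsto_atTop.2 fun B => ?_
  -- choose k large so that `V/ℓ ≥ M` with `M := (2(|q|+1))/δ`, and `V ≥ V₀` where `|q| log(V+1) ≤ δ V/4 ` and `δ V/4 ≥ B`
  have hq0 : 0 ≤ |q| := abs_nonneg q
  -- (1) `|q| log(V+1) ≤ (δ/4) V` for large `V`: from `log(V+1) ≤ 2√V`-type bounds; we use `log x ≤ x/e`-free route:
  -- `log (V+1) ≤ (δ/(4(|q|+1))) (V+1) + C'` is messy; instead use `Real.tendsto_log_atTop`-free elementary fact
  -- `log y ≤ y / t - ... `: Mathlib `Real.log_le_sub_one_of_pos` gives `log y ≤ y - 1`; apply to `y = (V+1)^{…}`? Simpler: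
  -- `log (V+1) = (1/r) log ((V+1)^r) ≤ (1/r) ((V+1)^r - 1)` is also messy. Use `isLittleO_log_id_atTop`.
  have hlog_o : ∀ᶠ x : ℝ in atTop, |q| * Real.log (x + 1) ≤ δ / 4 * x := by
    have h := Real.isLittleO_log_id_atTop
    -- `log x = o(x)`; shift by one: `log(x+1) ≤ log(2x) = log 2 + log x` for `x ≥ 1`
    have hc : 0 < δ / (8 * (|q| + 1)) := by positivity
    have h' := h.bound hc
    filter_upwards [h', eventually_ge_atTop (1 : ℝ),
      eventually_ge_atTop (8 * (|q| + 1) * Real.log 2 / δ)] with x hx hx1 hx2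
    have hxpos : 0 < x := by linarith
    simp only [Real.norm_eq_abs, id] at hx
    rw [abs_of_pos hxpos] at hx
    have hlogx : Real.log x ≤ δ / (8 * (|q| + 1)) * x := (le_abs_self _).trans hx
    have hlog2x : Real.log (x + 1) ≤ Real.log 2 + Real.log x := by
      rw [← Real.log_mul (by norm_num) hxpos.ne']
      exact Real.log_le_log (by linarith) (by linarith)
    have hq1 : |q| ≤ |q| + 1 := by linarith
    calc |q| * Real.log (x + 1) ≤ (|q| + 1) * (Real.log 2 + δ / (8 * (|q| + 1)) * x) := by
          have : 0 ≤ Real.log 2 + δ / (8 * (|q| + 1)) * x := by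
            have hl2 : 0 ≤ Real.log 2 := Real.log_nonneg (by norm_num)
            have : 0 ≤ δ / (8 * (|q| + 1)) * x := by positivity
            linarith
          have hstep : Real.log (x + 1) ≤ Real.log 2 + δ / (8 * (|q| + 1)) * x := by linarith [hlog2x, hlogx]
          calc |q| * Real.log (x + 1) ≤ |q| * (Real.log 2 + δ / (8 * (|q| + 1)) * x) :=
                mul_le_mul_of_nonneg_left hstep hq0
            _ ≤ (|q| + 1) * (Real.log 2 + δ / (8 * (|q| + 1)) * x) :=
                mul_le_mul_of_nonneg_right hq1 this
      _ = (|q| + 1) * Real.log 2 + δ / 8 * x := by field_simp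
      _ ≤ δ / 4 * x := by
          have : (|q| + 1) * Real.log 2 ≤ δ / 8 * x := by
            rw [div_le_iff₀ hδ] at hx2
            nlinarith [hx2]
          linarith
  -- (2) `|q| |log a| ≤ (δ/4) V` eventually, from `V/ℓ → ∞`
  have hlog_a : ∀ᶠ k in atTop, |q| * |Real.log (a k)| ≤ δ / 4 * V k := by
    have h := hvol.eventually_ge_atTop (4 * (|q| + 1) / δ)
    filter_upwards [h] with k hk
    change 4 * (|q| + 1) / δ ≤ V k / ℓ k at hk
    rw [div_le_div_iff₀ hδ (hℓpos k)] at hk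
    have hℓk : |Real.log (a k)| ≤ ℓ k := by simp only [hℓ]; linarith [abs_nonneg (Real.log (a k))]
    have : |q| * |Real.log (a k)| ≤ (|q| + 1) * ℓ k :=
      mul_le_mul (by linarith) hℓk (abs_nonneg _) (by positivity)
    nlinarith [this, hℓpos k]
  -- assemble
  have hV1 := hVtop.eventually (hlog_o)
  have hVB := hVtop.eventually_ge_atTop (4 * (|B| + 1) / δ)
  filter_upwards [hV1, hlog_a, hlogL, hVB] with k h1 h2 h3 h4
  have hqlog : q * Real.log ((L k : ℝ) + 1) ≤ |q| * (Real.log (V k + 1) + |Real.log (a k)|) := by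
    have hL0 : 0 ≤ Real.log ((L k : ℝ) + 1) := Real.log_nonneg (by linarith [Nat.cast_nonneg (α := ℝ) (L k)])
    calc q * Real.log ((L k : ℝ) + 1) ≤ |q| * Real.log ((L k : ℝ) + 1) :=
          mul_le_mul_of_nonneg_right (le_abs_self q) hL0
      _ ≤ |q| * (Real.log (V k + 1) + |Real.log (a k)|) := mul_le_mul_of_nonneg_left h3 hq0
  have h1' : |q| * Real.log (V k + 1) ≤ δ / 4 * V k := h1
  have hB4 : B ≤ δ / 2 * V k := by
    rw [div_le_iff₀ hδ] at h4
    have h4' : δ / 2 * V k = (V k * δ) / 2 := by ring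
    rw [h4']
    linarith [le_abs_self B, abs_nonneg B, h4]
  change B ≤ δ * V k - q * Real.log ((L k : ℝ) + 1)
  nlinarith [hqlog, h1', h2, hB4, mul_add (|q|) (Real.log (V k + 1)) (|Real.log (a k)|)]

/-- **Eventual lower pin ⇒ violation at the scheme volume, eventually in `k`** (superlog physical volume):
for every `ε > C₁` and every `C`, eventually `C e^{-ε a_k L_k} < F k L_k L_k`. [folklore] -/
theorem eventually_violation_at_schemeVolume_of_eventual_lowerPin :
    ∀ (a : ℕ → ℝ) (L : ℕ → ℕ) (F : ℕ → ℕ → ℕ → ℝ) (c₀ C₁ p ε : ℝ), (∀ k, 0 < a k) → (∀ᶠ k in Filter.atTop, a k ≤ 1) → Filter.Tendsto (fun k => a k * L k / (1 + |Real.log (a k)|)) Filter.atTop Filter.atTop → 0 < c₀ → C₁ < ε → (∀ᶠ k in Filter.atTop, ∀ S : ℕ, L k ≤ S → ∀ n : ℕ, n ≤ S → c₀ * Real.exp (-(C₁ * (a k * n) + p * Real.log (n + 1))) ≤ F k S n) → ∀ C : ℝ, ∀ᶠ k in Filter.atTop, C * Real.exp (-(ε * (a k * L k))) < F k (L k) (L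 k) := by
  intro a L F c₀ C₁ p ε ha ha1 hvol hc₀ hε h C
  have hδ : 0 < ε - C₁ := sub_pos.2 hε
  have hT := tendsto_mul_vol_sub_log_atTop a L hδ p ha ha1 hvol
  -- eventually `exp(δ V - p log(L+1)) > C / c₀`
  have hbig : ∀ᶠ k in atTop, C / c₀ < Real.exp ((ε - C₁) * (a k * L k) - p * Real.log ((L k : ℝ) + 1)) :=
    (Real.tendsto_exp_atTop.comp hT).eventually_gt_atTop (C / c₀)
  filter_upwards [h, hbig] with k hk hkbig
  have hlow := hk (L k) le_rfl (L k) le_rfl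
  refine lt_of_lt_of_le ?_ hlow
  have hL0 : (0 : ℝ) < (L k : ℝ) + 1 := by positivity
  -- `c₀ e^{-(C₁ a L + p log(L+1))} = e^{-ε a L} · c₀ e^{(ε - C₁) a L - p log(L+1)}`
  have hsplit : c₀ * Real.exp (-(C₁ * (a k * (L k : ℕ)) + p * Real.log ((L k : ℕ) + 1))) =
      Real.exp (-(ε * (a k * L k))) * (c₀ * Real.exp ((ε - C₁) * (a k * L k) - p * Real.log ((L k : ℝ) + 1))) := by
    rw [mul_left_comm (Real.exp _) c₀, ← Real.exp_add]
    congr 1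
    congr 1
    ring
  rw [hsplit]
  have hpos : 0 < Real.exp (-(ε * (a k * L k))) := Real.exp_pos _
  have hC : C < c₀ * Real.exp ((ε - C₁) * (a k * L k) - p * Real.log ((L k : ℝ) + 1)) := by
    rw [div_lt_iff₀ hc₀] at hkbig; linarith
  calc C * Real.exp (-(ε * (a k * ↑(L k)))) = Real.exp (-(ε * (a k * L k))) * C := mul_comm _ _
    _ < Real.exp (-(ε * (a k * L k))) * (c₀ * Real.exp ((ε - C₁) * (a k * L k) - p * Real.log ((L k : ℝ) + 1))) :=
        mul_lt_mul_of_pos_left hC hpos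

end Summit.QuantumFields.QCD.Cruxes.ChiralOneScaleTrajectory.GoldstoneWitness
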